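/-
Copyright: b2b-lace packet (LEAN TYPING SEAT 1 gen 34, node KU-SEP-SINKEPT-BALL).
The ORDER BALL of a sin²-KEPT row in the kernel's folded row format, RELATIVE form: truncating the
twist expansion of `T^{(a,sin²)}_m(v,y)` at order `J` costs `2 δ_J(y)` times the kept anchor
`π (I_0 − I_2)(v)` — no index shift, but the `1/v` decay that makes sharp-range tails summable.
Elementary; hypothesis-free; no `sorry`; nothing at a specific dimension; no number.
-/
import Literature.Probability.FitznerVanDerHofstad2017.SrwTwistSinKeptSlices
import Literature.Probability.FitznerVanDerHofstad2017.SrwAxisTransformBesselForm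
import Literature.Probability.LatticeModels.BesselIRatioBounds
import HarnessLib

/-!
# The kept-row order ball (relative form)

CITATION HEADER (PLACEMENT v2). Part of the certified REPRODUCTION of the numerical inputs of
R. Fitzner, R. van der Hofstad, *Generalized approach to the non-backtracking lace expansion*,
Probab. Theory Related Fields 169 (2017) 1041–1119 [NoBLE17-I] (arXiv:1506.07969), §3.3.3 and
(3.34)–(3.38) p. 1070–1071 (the `D̂^{sin}`-inserted twisted SRW moments), §5.1.1 (5.2)–(5.5) p. 1089–1090
(one-dimensional Bessel rows and their truncation), §5.2 (5.10) p. 1092, as consumed by *Mean-field behavior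
for nearest-neighbor percolation in `d > 10`*, Electron. J. Probab. 22 (2017) no. 43.  Origin: build `lace`,
unit `b2b-lace-lean1-g34`, node KU-SEP-SINKEPT-BALL (what-if / input-certification support; d-free,
number-free; nothing here is a certificate).

## What is proved, and why

`SrwTwistCosPowRow.lean` expands the `cos^a`-inserted row
`T^{(a)}_m(v,y) = ∫_{[-π,π]} cos^a t · e^{v cos t + iy cos(mt)} dt = Σ_{j≥0} ε_j W^{(a)}_j(v) · 2π iʲ J_j(y)`,
`W^{(a)}_j(v) = 2^{-a} Σ_s C(a,s) I_{jm−(2s−a)}(v)`, and bounds its truncation at order `J` by the SHIFTED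
plain weight `4π I_{(J+1)|m|−a}(v) δ_J(y)`, `δ_J(y) = Σ_{l≥0}|J_{l+J+1}(y)|` (`norm_cosPowRow_sub_foldTrunc_le`).
For a row with a KEPT `sin²` — `T^{(a,sin²)} = T^{(a)} − T^{(a+2)}` (`integral_cos_pow_mul_sin_sq_row_eq_sub`),
weights `W^{(a)}_j − W^{(a+2)}_j` — that bound loses the second-order vanishing of `sin²` at `t = 0`, i.e. the
factor `1/v` by which the kept anchor `∫ sin² e^{v cos t} dt = π(I_0 − I_2)(v) = 2π I_1(v)/v` is smaller than
`2π I_0(v)`; and it is exactly that factor which makes the `τ`-tails of sin²-kept product rows summable one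
`Ĉ`-power beyond the bounded-weight range (`SrwTwistSinKeptSlices.lean`).  Here:

* `cosPowWeight_eq_integral`: `W^{(a)}_j(v) = (2π)⁻¹ ∫ cos^a t · e^{v cos t} e^{−i jm t} dt` (the character
  integral `∫ e^{v cos t} e^{−int} dt = 2π I_n(v)`, DLMF 10.32.3, tree `integral_cexp_cosh_mul_cexp`);
* `norm_cosPowWeight_sub_le`: `‖W^{(a)}_j − W^{(a+2)}_j‖(v) ≤ (I_0(v) − I_2(v))/2` uniformly in `j, m`
  (the kept weight is `(2π)⁻¹∫ cos^a sin² e^{v cos t} e^{−ijmt}`), and the sin⁴ analogue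
  `‖W^{(a)}_j − 2W^{(a+2)}_j + W^{(a+4)}_j‖ ≤ (3I_0 − 4I_2 + I_4)(v)/8` (`∫ sin⁴ e^{v cos t} = (π/4)(3I_0 − 4I_2 + I_4)`);
* **`norm_cosPowSinSqRow_sub_foldTrunc_le`**: for `m ≠ 0` and ALL `v, y, a, J`,
  `‖T^{(a,sin²)}_m(v,y) − Σ_{j≤J} ε_j (W^{(a)}_j − W^{(a+2)}_j)(v) · 2π iʲ J_j(y)‖ ≤ 2π (I_0 − I_2)(v) · δ_J(y)`
  — the kept row's truncation object is the difference of two cos-power row objects of the established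
  format, and the ball is `2 δ_J ×` the kept anchor; `norm_cosPowSinSqSinSqRow_sub_foldTrunc_le` is the sin⁴
  row (`j = j′` in `Dhat_pow_mul_Dsin_sq_eq_sum`), ball `(π/2)(3I_0 − 4I_2 + I_4)(v) · δ_J(y)`;
* **`cosPowWeight_sub_eq_sum_recurrence`** (the RECURRENCE FORM, for kernels): for `v ≠ 0`,
  `W^{(a)}_j(v) − W^{(a+2)}_j(v) = 2^{-a} Σ_{s≤a} C(a,s)·((k_s+1) I_{k_s+1}(v) − (k_s−1) I_{k_s−1}(v))/(2v)`,
  `k_s = jm − (2s−a)`, from `∫ sin²t e^{v cos t} e^{−ikt} dt = 2π((k+1)I_{k+1} − (k−1)I_{k−1})(v)/(2v)`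
  (`integral_sin_sq_mul_cexp_mul_cexp_neg_μI`; the recurrence `x I_{k−1} − x I_{k+1} = 2k I_k` at every integer
  order, `besselI_recurrence_int`) — each term of a kept literal object thus carries `d/τ` explicitly and is a
  finite plain seed one moment index lower, although the kept weight's Bessel summands individually are not;
* **`cosPowWeight_sub_two_mul_add_eq_sum_recurrence`** (second order, the `j = j′` / sin⁴ kept weight):
  `W^{(a)}_j − 2W^{(a+2)}_j + W^{(a+4)}_j
   = 2^{-a} Σ_{s≤a} C(a,s)·((k_s+2)(k_s+3) I_{k_s+2} − 2k_s² I_{k_s} + (k_s−2)(k_s−3) I_{k_s−2})(v)/(4v²)`, from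
  `∫ sin⁴t e^{v cos t} e^{−ikt} dt = 2π((k+2)(k+3)I_{k+2} − 2k²I_k + (k−2)(k−3)I_{k−2})(v)/(4v²)`
  (`integral_sin_sq_mul_sin_sq_mul_cexp_mul_cexp_neg_μI`; seven instances of the recurrence,
  `sq_mul_sinFour_besselI_combo_eq`) — each such term carries `(d/τ)²` and lands two moment indices lower.

Use (d-generic): with every row `μ` anchored at `A_μ(v) = ∫ G_μ e^{v cos t} dt` (`G_μ ∈ {1, sin², sin⁴}`) and
its ball `2δ_J A_μ`, `|Π_μ T_μ − Π_μ P_μ| ≤ ((1 + 2δ_J)^d − 1) Π_μ A_μ(τ/d)` pointwise in `τ`, and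
`(n!)⁻¹ ∫₀^∞ τⁿ e^{−τ} Π_μ A_μ(τ/d) dτ/(2π)^d` is the KEPT SEED `Tw_{n+1}[Π_{kept μ} sin²(k_μ)](·; 0)`,
finite in the sharp range `d ≥ 2n+1` plus one `Ĉ`-power per kept factor.

## References
* [NoBLE17-I] R. Fitzner, R. van der Hofstad, PTRF 169 (2017) 1041–1119; arXiv:1506.07969 — §3.3.3,
  (3.34)–(3.38) p. 1070–1071; §5.1.1 (5.2)–(5.5) p. 1089–1090; §5.2 (5.10) p. 1092.
* [DLMF] NIST Digital Library of Mathematical Functions — 10.29.1 (recurrence), 10.32.3 (`I_n` as a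
  trigonometric integral), 10.35.2 (generating function), 10.14.4 / 10.37 (tails).
* [Watson1944] G. N. Watson, *A Treatise on the Theory of Bessel Functions*, 2nd ed., CUP 1944 — §2.22.
* [Amos1974] D. E. Amos, *Computation of modified Bessel functions and their ratios*, Math. Comp. 28 (1974) 239–251 — (1).
-/

noncomputable section

open MeasureTheory Set Filter Real
open scoped Topology Nat

namespace Literature.Probability.FitznerVanDerHofstad2017

open Literature.Barriers.CriticalPhenomena
open Literature.Barriers.CriticalPhenomena.Slade2006Prop53 (μI P)
open Literature.Probability.LatticeModels (besselI besselI_neg_index besselI_recurrence integral_cexp_cosh_mul_cexp)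
open Literature.Analysis.FunctionSpaces (besselJ)

/-! ### `∫ sin⁴ e^{v cos t}` -/

/-- `∫_{[-π,π]} sin²t sin²t e^{v cos t} dt = (π/4)(3I_0(v) − 4I_2(v) + I_4(v))` (`sin⁴ = (3 − 4cos 2t + cos 4t)/8`).
[cite: DLMF, 10.32.3] -/
theorem integral_sin_sq_mul_sin_sq_mul_exp_mul_cos_μI (v : ℝ) :
    ∫ t, Real.sin t ^ 2 * Real.sin t ^ 2 * Real.exp (v * Real.cos t) ∂μI
      = π / 4 * (3 * besselI 0 v - 4 * besselI 2 v + besselI 4 v) := by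
  have h0 := integral_exp_mul_cos_μI v
  have h2 := integral_cos_mul_exp_mul_cos_muI v 2
  have h4 := integral_cos_mul_exp_mul_cos_muI v 4
  have hi0 : Integrable (fun t : ℝ => Real.exp (v * Real.cos t)) μI := by
    have hc : Continuous (fun t : ℝ => Real.exp (v * Real.cos t)) := by fun_prop
    exact hc.continuousOn.integrableOn_compact isCompact_Icc
  have hin : ∀ n : ℤ, Integrable (fun t : ℝ => Real.cos ((n : ℝ) * t) * Real.exp (v * Real.cos t)) μI := by
    intro n
    have hc : Continuous (fun t : ℝ => Real.cos ((n : ℝ) * t) * Real.exp (v * Real.cos t)) := by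
      fun_prop
    exact hc.continuousOn.integrableOn_compact isCompact_Icc
  have hptw : (fun t : ℝ => Real.sin t ^ 2 * Real.sin t ^ 2 * Real.exp (v * Real.cos t))
      = fun t => ((3 / 8) * Real.exp (v * Real.cos t)
        - (1 / 2) * (Real.cos (((2 : ℤ) : ℝ) * t) * Real.exp (v * Real.cos t)))
        + (1 / 8) * (Real.cos (((4 : ℤ) : ℝ) * t) * Real.exp (v * Real.cos t)) := by
    funext t
    have hc2 : Real.cos (((2 : ℤ) : ℝ) * t) = 2 * Real.cos t ^ 2 - 1 := by
      rw [show (((2 : ℤ) : ℝ)) = 2 by norm_num, Real.cos_two_mul]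
    have hc4 : Real.cos (((4 : ℤ) : ℝ) * t) = 2 * (2 * Real.cos t ^ 2 - 1) ^ 2 - 1 := by
      rw [show (((4 : ℤ) : ℝ)) * t = 2 * (2 * t) by push_cast; ring, Real.cos_two_mul, Real.cos_two_mul]
    rw [hc2, hc4, Real.sin_sq]
    ring
  have hA : Integrable (fun t : ℝ => (3 / 8) * Real.exp (v * Real.cos t)
      - (1 / 2) * (Real.cos (((2 : ℤ) : ℝ) * t) * Real.exp (v * Real.cos t))) μI :=
    (hi0.const_mul _).sub ((hin 2).const_mul _)
  have hB : Integrable (fun t : ℝ => (1 / 8) * (Real.cos (((4 : ℤ) : ℝ) * t) * Real.exp (v * Real.cos t)))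
      μI := (hin 4).const_mul _
  rw [hptw, integral_add hA hB, integral_sub (hi0.const_mul _) ((hin 2).const_mul _),
    integral_const_mul, integral_const_mul, integral_const_mul, h0, h2, h4]
  ring

/-! ### The cos-power row weights as character integrals -/

/-- `∫_{[-π,π]} e^{v cos t} e^{−int} dt = 2π I_n(v)` (complex form of DLMF 10.32.3, from the tree's shifted-contour
representation `integral_cexp_cosh_mul_cexp` at `r = 0`). [cite: DLMF, 10.32.3] -/
theorem integral_cexp_mul_cos_mul_cexp_neg_μI (v : ℝ) (n : ℤ) :
    ∫ t, Complex.exp (((v * Real.cos t : ℝ) : ℂ)) * Complex.exp (-((n : ℂ) * t * Complex.I)) ∂μI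
      = ((2 * π * besselI n v : ℝ) : ℂ) := by
  have h := integral_cexp_cosh_mul_cexp v 0 n
  simp only [Complex.ofReal_zero, zero_add, Complex.cosh_mul_I, mul_zero, Real.exp_zero, mul_one] at h
  rw [show μI = volume.restrict (Icc (-π) π) from rfl, integral_Icc_eq_integral_Ioc,
    ← intervalIntegral.integral_of_le (by linarith [Real.pi_pos] : -π ≤ π), ← h]
  refine intervalIntegral.integral_congr fun t _ => ?_
  simp only [Complex.ofReal_mul, Complex.ofReal_cos]

/-- **The `cos^a` row weight is a character integral**:
`W^{(a)}_j(v) = 2^{-a} Σ_{s≤a} C(a,s) I_{jm−(2s−a)}(v) = (2π)⁻¹ ∫_{[-π,π]} cos^a t · e^{v cos t} e^{−i jm t} dt`.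
[cite: DLMF, 10.32.3, 10.35.2; FitznerVanDerHofstad2016NoBLE, §5.1.1 (5.2)–(5.4)] -/
theorem cosPowWeight_eq_integral (a : ℕ) (v : ℝ) (m j : ℤ) :
    (∑ s ∈ Finset.range (a + 1),
        ((a.choose s : ℂ) / 2 ^ a) * (besselI (j * m - ((2 * (s : ℤ) - a : ℤ))) v : ℂ))
      = (2 * π : ℂ)⁻¹ * ∫ t, (((Real.cos t) ^ a : ℝ) : ℂ) * (Complex.exp (((v * Real.cos t : ℝ) : ℂ))
          * Complex.exp (-(((j * m : ℤ) : ℂ) * t * Complex.I))) ∂μI := by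
  have hπ : (2 * π : ℂ) ≠ 0 := by
    have : (0 : ℝ) < 2 * π := by positivity
    exact_mod_cast this.ne'
  -- each Bessel weight as a character integral
  have hI : ∀ r : ℤ, (besselI (j * m - r) v : ℂ) = (2 * π : ℂ)⁻¹
      * ∫ t, Complex.exp (((v * Real.cos t : ℝ) : ℂ))
          * Complex.exp (-(((j * m - r : ℤ) : ℂ) * t * Complex.I)) ∂μI := by
    intro r
    rw [integral_cexp_mul_cos_mul_cexp_neg_μI v (j * m - r)]
    push_cast
    field_simp
  -- integrability of the pieces
  have hint : ∀ r : ℤ, Integrable (fun t : ℝ => Complex.exp (((v * Real.cos t : ℝ) : ℂ))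
      * Complex.exp (-(((j * m - r : ℤ) : ℂ) * t * Complex.I))) μI := by
    intro r
    have hc : Continuous (fun t : ℝ => Complex.exp (((v * Real.cos t : ℝ) : ℂ))
        * Complex.exp (-(((j * m - r : ℤ) : ℂ) * t * Complex.I))) := by fun_prop
    exact hc.continuousOn.integrableOn_compact isCompact_Icc
  have hstep : ∀ s ∈ Finset.range (a + 1),
      ((a.choose s : ℂ) / 2 ^ a) * (besselI (j * m - ((2 * (s : ℤ) - a : ℤ))) v : ℂ)
        = (2 * π : ℂ)⁻¹ * ∫ t, ((a.choose s : ℂ) / 2 ^ a) * (Complex.exp (((v * Real.cos t : ℝ) : ℂ))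
            * Complex.exp (-(((j * m - ((2 * (s : ℤ) - a : ℤ)) : ℤ) : ℂ) * t * Complex.I))) ∂μI := by
    intro s _
    rw [hI, integral_const_mul]
    ring
  rw [Finset.sum_congr rfl hstep, ← Finset.mul_sum, ← integral_finsetSum _ (fun s _ =>
    (hint _).const_mul _)]
  congr 1
  refine integral_congr_ae (ae_of_all _ fun t => ?_)
  beta_reduce
  rw [ofReal_cos_pow_eq_sum_cexp, Finset.sum_mul]
  refine Finset.sum_congr rfl fun s _ => ?_
  have he : Complex.exp (-(((j * m - ((2 * (s : ℤ) - a : ℤ)) : ℤ) : ℂ) * t * Complex.I))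
      = Complex.exp ((((2 * (s : ℤ) - a : ℤ)) : ℂ) * t * Complex.I)
        * Complex.exp (-(((j * m : ℤ) : ℂ) * t * Complex.I)) := by
    rw [← Complex.exp_add]
    congr 1
    push_cast
    ring
  rw [he]
  ring

/-- The norm of the character-integral kernel: `‖e^{v cos t} e^{−ijmt}‖ = e^{v cos t}`. [folklore] -/
private theorem norm_cexp_mul_cexp_neg (v t : ℝ) (c : ℤ) :
    ‖Complex.exp (((v * Real.cos t : ℝ) : ℂ)) * Complex.exp (-((c : ℂ) * t * Complex.I))‖
      = Real.exp (v * Real.cos t) := by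
  rw [norm_mul, Complex.norm_exp_ofReal,
    show -((c : ℂ) * t * Complex.I) = (((-(c : ℝ) * t) : ℝ) : ℂ) * Complex.I by push_cast; ring,
    Complex.norm_exp_ofReal_mul_I, mul_one]

/-- **The kept-`sin²` weight is anchored at `(I_0 − I_2)/2`**: for all `a, v, m, j`,
`‖W^{(a)}_j(v) − W^{(a+2)}_j(v)‖ ≤ (I_0(v) − I_2(v))/2` — the difference is
`(2π)⁻¹ ∫ cos^a t sin²t · e^{v cos t} e^{−ijmt} dt`, bounded by `(2π)⁻¹ ∫ sin²t e^{v cos t} dt = (I_0 − I_2)(v)/2 = I_1(v)/v`.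
[cite: DLMF, 10.32.3; FitznerVanDerHofstad2016NoBLE, §5.1.1 (5.2)–(5.4), §5.2 (5.10) p. 1092] -/
theorem norm_cosPowWeight_sub_le (a : ℕ) (v : ℝ) (m j : ℤ) :
    ‖(∑ s ∈ Finset.range (a + 1),
        ((a.choose s : ℂ) / 2 ^ a) * (besselI (j * m - ((2 * (s : ℤ) - a : ℤ))) v : ℂ))
      - ∑ s ∈ Finset.range (a + 2 + 1),
        (((a + 2).choose s : ℂ) / 2 ^ (a + 2))
          * (besselI (j * m - ((2 * (s : ℤ) - (a + 2 : ℕ) : ℤ))) v : ℂ)‖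
      ≤ (besselI 0 v - besselI 2 v) / 2 := by
  have hπ0 : (0 : ℝ) < 2 * π := by positivity
  set K : ℝ → ℂ := fun t => Complex.exp (((v * Real.cos t : ℝ) : ℂ))
    * Complex.exp (-(((j * m : ℤ) : ℂ) * t * Complex.I)) with hK
  have hKn : ∀ t, ‖K t‖ = Real.exp (v * Real.cos t) := fun t => norm_cexp_mul_cexp_neg v t (j * m)
  have hint : ∀ b : ℕ, Integrable (fun t : ℝ => (((Real.cos t) ^ b : ℝ) : ℂ) * K t) μI := by
    intro b
    have hc : Continuous (fun t : ℝ => (((Real.cos t) ^ b : ℝ) : ℂ) * K t) := by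
      simp only [hK]; fun_prop
    exact hc.continuousOn.integrableOn_compact isCompact_Icc
  rw [cosPowWeight_eq_integral a v m j, cosPowWeight_eq_integral (a + 2) v m j, ← mul_sub,
    ← integral_sub (hint a) (hint (a + 2))]
  have hpt : ∀ t : ℝ, (((Real.cos t) ^ a : ℝ) : ℂ) * K t - (((Real.cos t) ^ (a + 2) : ℝ) : ℂ) * K t
      = (((Real.cos t) ^ a * Real.sin t ^ 2 : ℝ) : ℂ) * K t := by
    intro t
    simp only [Real.sin_sq]
    push_cast
    ring
  simp_rw [hpt]
  have hbd : ∀ t : ℝ, ‖(((Real.cos t) ^ a * Real.sin t ^ 2 : ℝ) : ℂ) * K t‖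
      ≤ Real.sin t ^ 2 * Real.exp (v * Real.cos t) := by
    intro t
    rw [norm_mul, hKn, Complex.norm_real, Real.norm_eq_abs, abs_mul, abs_pow,
      abs_of_nonneg (sq_nonneg (Real.sin t))]
    refine mul_le_mul_of_nonneg_right ?_ (Real.exp_pos _).le
    exact mul_le_of_le_one_left (sq_nonneg _) (pow_le_one₀ (abs_nonneg _) (abs_cos_le_one t))
  have hi2 : Integrable (fun t : ℝ => Real.sin t ^ 2 * Real.exp (v * Real.cos t)) μI := by
    have hc : Continuous (fun t : ℝ => Real.sin t ^ 2 * Real.exp (v * Real.cos t)) := by fun_prop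
    exact hc.continuousOn.integrableOn_compact isCompact_Icc
  have h1 : ‖∫ t, (((Real.cos t) ^ a * Real.sin t ^ 2 : ℝ) : ℂ) * K t ∂μI‖
      ≤ π * (besselI 0 v - besselI 2 v) := by
    refine (norm_integral_le_of_norm_le hi2 (ae_of_all _ hbd)).trans_eq ?_
    exact integral_sin_sq_mul_exp_mul_cos_μI v
  rw [norm_mul, norm_inv, show ‖(2 * π : ℂ)‖ = 2 * π by
    rw [show (2 * π : ℂ) = ((2 * π : ℝ) : ℂ) by push_cast; ring, Complex.norm_real, Real.norm_eq_abs,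
      abs_of_pos hπ0]]
  rw [inv_mul_le_iff₀ hπ0]
  linarith

/-- **The sin⁴ weight is anchored at `(3I_0 − 4I_2 + I_4)/8`**: for all `a, v, m, j`,
`‖W^{(a)}_j − 2W^{(a+2)}_j + W^{(a+4)}_j‖(v) ≤ (3I_0 − 4I_2 + I_4)(v)/8`
(`(2π)⁻¹ ∫ sin⁴ e^{v cos t} = (3I_0 − 4I_2 + I_4)/8`).
[cite: DLMF, 10.32.3; FitznerVanDerHofstad2016NoBLE, §5.1.1 (5.2)–(5.4), §5.2 (5.10), (5.14) p. 1092] -/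
theorem norm_cosPowWeight_sub_two_mul_add_le (a : ℕ) (v : ℝ) (m j : ℤ) :
    ‖(∑ s ∈ Finset.range (a + 1),
        ((a.choose s : ℂ) / 2 ^ a) * (besselI (j * m - ((2 * (s : ℤ) - a : ℤ))) v : ℂ))
      - 2 * (∑ s ∈ Finset.range (a + 2 + 1),
        (((a + 2).choose s : ℂ) / 2 ^ (a + 2))
          * (besselI (j * m - ((2 * (s : ℤ) - (a + 2 : ℕ) : ℤ))) v : ℂ))
      + ∑ s ∈ Finset.range (a + 4 + 1),
        (((a + 4).choose s : ℂ) / 2 ^ (a + 4))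
          * (besselI (j * m - ((2 * (s : ℤ) - (a + 4 : ℕ) : ℤ))) v : ℂ)‖
      ≤ (3 * besselI 0 v - 4 * besselI 2 v + besselI 4 v) / 8 := by
  have hπ0 : (0 : ℝ) < 2 * π := by positivity
  set K : ℝ → ℂ := fun t => Complex.exp (((v * Real.cos t : ℝ) : ℂ))
    * Complex.exp (-(((j * m : ℤ) : ℂ) * t * Complex.I)) with hK
  have hKn : ∀ t, ‖K t‖ = Real.exp (v * Real.cos t) := fun t => norm_cexp_mul_cexp_neg v t (j * m)
  have hint : ∀ b : ℕ, Integrable (fun t : ℝ => (((Real.cos t) ^ b : ℝ) : ℂ) * K t) μI := by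
    intro b
    have hc : Continuous (fun t : ℝ => (((Real.cos t) ^ b : ℝ) : ℂ) * K t) := by
      simp only [hK]; fun_prop
    exact hc.continuousOn.integrableOn_compact isCompact_Icc
  rw [cosPowWeight_eq_integral a v m j, cosPowWeight_eq_integral (a + 2) v m j,
    cosPowWeight_eq_integral (a + 4) v m j]
  have hcomb : (2 * π : ℂ)⁻¹ * (∫ t, (((Real.cos t) ^ a : ℝ) : ℂ) * K t ∂μI)
      - 2 * ((2 * π : ℂ)⁻¹ * ∫ t, (((Real.cos t) ^ (a + 2) : ℝ) : ℂ) * K t ∂μI)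
      + (2 * π : ℂ)⁻¹ * (∫ t, (((Real.cos t) ^ (a + 4) : ℝ) : ℂ) * K t ∂μI)
      = (2 * π : ℂ)⁻¹ * ∫ t, (((Real.cos t) ^ a * Real.sin t ^ 2 * Real.sin t ^ 2 : ℝ) : ℂ) * K t ∂μI := by
    have hpt : ∀ t : ℝ, (((Real.cos t) ^ a * Real.sin t ^ 2 * Real.sin t ^ 2 : ℝ) : ℂ) * K t
        = ((((Real.cos t) ^ a : ℝ) : ℂ) * K t - 2 * ((((Real.cos t) ^ (a + 2) : ℝ) : ℂ) * K t))
          + (((Real.cos t) ^ (a + 4) : ℝ) : ℂ) * K t := by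
      intro t
      simp only [Real.sin_sq]
      push_cast
      ring
    simp_rw [hpt]
    have hAB : Integrable (fun t : ℝ => (((Real.cos t) ^ a : ℝ) : ℂ) * K t
        - 2 * ((((Real.cos t) ^ (a + 2) : ℝ) : ℂ) * K t)) μI :=
      (hint a).sub ((hint (a + 2)).const_mul 2)
    rw [integral_add hAB (hint (a + 4)), integral_sub (hint a) ((hint (a + 2)).const_mul 2),
      integral_const_mul]
    ring
  rw [hcomb]
  have hbd : ∀ t : ℝ, ‖(((Real.cos t) ^ a * Real.sin t ^ 2 * Real.sin t ^ 2 : ℝ) : ℂ) * K t‖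
      ≤ Real.sin t ^ 2 * Real.sin t ^ 2 * Real.exp (v * Real.cos t) := by
    intro t
    rw [norm_mul, hKn, Complex.norm_real, Real.norm_eq_abs, abs_mul, abs_mul, abs_pow,
      abs_of_nonneg (sq_nonneg (Real.sin t))]
    have h1 : |Real.cos t| ^ a ≤ 1 := pow_le_one₀ (abs_nonneg _) (abs_cos_le_one t)
    have h0 : 0 ≤ Real.sin t ^ 2 * Real.sin t ^ 2 * Real.exp (v * Real.cos t) := by positivity
    calc |Real.cos t| ^ a * Real.sin t ^ 2 * Real.sin t ^ 2 * Real.exp (v * Real.cos t)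
        = |Real.cos t| ^ a * (Real.sin t ^ 2 * Real.sin t ^ 2 * Real.exp (v * Real.cos t)) := by ring
      _ ≤ Real.sin t ^ 2 * Real.sin t ^ 2 * Real.exp (v * Real.cos t) := mul_le_of_le_one_left h0 h1
  have hi4 : Integrable (fun t : ℝ => Real.sin t ^ 2 * Real.sin t ^ 2 * Real.exp (v * Real.cos t)) μI := by
    have hc : Continuous (fun t : ℝ => Real.sin t ^ 2 * Real.sin t ^ 2 * Real.exp (v * Real.cos t)) := by
      fun_prop
    exact hc.continuousOn.integrableOn_compact isCompact_Icc
  have h1 : ‖∫ t, (((Real.cos t) ^ a * Real.sin t ^ 2 * Real.sin t ^ 2 : ℝ) : ℂ) * K t ∂μI‖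
      ≤ π / 4 * (3 * besselI 0 v - 4 * besselI 2 v + besselI 4 v) := by
    refine (norm_integral_le_of_norm_le hi4 (ae_of_all _ hbd)).trans_eq ?_
    exact integral_sin_sq_mul_sin_sq_mul_exp_mul_cos_μI v
  rw [norm_mul, norm_inv, show ‖(2 * π : ℂ)‖ = 2 * π by
    rw [show (2 * π : ℂ) = ((2 * π : ℝ) : ℂ) by push_cast; ring, Complex.norm_real, Real.norm_eq_abs,
      abs_of_pos hπ0]]
  rw [inv_mul_le_iff₀ hπ0]
  linarith

/-! ### The kept rows in the kernel's folded format -/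

/-- Folding a symmetric truncated `ℤ`-row: `Σ_{n≤J}(f_n + f_{-n}) − f_0 = Σ_{n≤J} ε_n f_n`. [folklore] -/
private theorem sum_range_add_neg_sub_eq_sum_eps' (f : ℤ → ℂ) (hf : ∀ n : ℕ, f (-(n : ℤ)) = f n)
    (J : ℕ) :
    ∑ n ∈ Finset.range (J + 1), (f n + f (-(n : ℤ))) - f 0
      = ∑ n ∈ Finset.range (J + 1), (if n = 0 then (1 : ℂ) else 2) * f n := by
  have h2 : ∀ n : ℕ, f n + f (-(n : ℤ)) = 2 * f n := fun n => by rw [hf, two_mul]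
  simp_rw [h2]
  rw [Finset.sum_range_succ' (fun n => 2 * f n),
    Finset.sum_range_succ' (fun n => (if n = 0 then (1 : ℂ) else 2) * f n)]
  simp only [Nat.cast_zero, if_true, one_mul, Nat.succ_ne_zero, if_false]
  ring

/-- `‖2π i^{|j|} J_{|j|}(y)‖ = 2π |J_{|j|}(y)|`. [folklore] -/
private theorem norm_twistFactor (y : ℝ) (j : ℤ) :
    ‖(2 * π * Complex.I ^ j.natAbs * (besselJ j.natAbs y : ℂ))‖ = 2 * π * |besselJ j.natAbs y| := by
  rw [norm_mul, norm_mul, norm_pow, Complex.norm_I, one_pow, mul_one, Complex.norm_real,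
    Real.norm_eq_abs, show (2 * π : ℂ) = ((2 * π : ℝ) : ℂ) by push_cast; ring, Complex.norm_real,
    Real.norm_eq_abs, abs_of_pos (by positivity : (0 : ℝ) < 2 * π)]

/-- **Relative order ball of a folded row**: if `Σ_{j∈ℤ} w_j · 2π i^{|j|} J_{|j|}(y) = T`, the weights are even
(`w_{-j} = w_j`) and `‖w_j‖ ≤ A` for all `j`, then
`‖T − Σ_{j≤J} ε_j w_j · 2π iʲ J_j(y)‖ ≤ 2 · (2π A) · Σ_{l≥0}|J_{l+J+1}(y)|`.
[cite: DLMF, 10.14.4; Watson1944, §2.22; FitznerVanDerHofstad2016NoBLE, §5.1.1 (5.4)–(5.5)] -/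
theorem norm_sub_foldTrunc_le_of_hasSum_of_norm_le (y : ℝ) {w : ℤ → ℂ} {T : ℂ}
    (hT : HasSum (fun j : ℤ => w j * (2 * π * Complex.I ^ j.natAbs * (besselJ j.natAbs y : ℂ))) T)
    (hsymm : ∀ n : ℕ, w (-(n : ℤ)) = w n) {A : ℝ} (hA : ∀ j, ‖w j‖ ≤ A) (J : ℕ) :
    ‖T - ∑ j ∈ Finset.range (J + 1), (if j = 0 then (1 : ℂ) else 2)
        * (w j * (2 * π * Complex.I ^ j * (besselJ j y : ℂ)))‖
      ≤ 2 * (2 * π * A) * ∑' l : ℕ, |besselJ (l + J + 1) y| := by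
  set g : ℤ → ℂ := fun j => w j * (2 * π * Complex.I ^ j.natAbs * (besselJ j.natAbs y : ℂ)) with hg
  have hgs : ∀ n : ℕ, g (-(n : ℤ)) = g n := fun n => by
    simp only [hg, Int.natAbs_neg, Int.natAbs_natCast, hsymm]
  have hb : ∀ j : ℤ, J + 1 ≤ j.natAbs → ‖g j‖ ≤ (2 * π * A) * |besselJ j.natAbs y| := by
    intro j _
    rw [hg, norm_mul, norm_twistFactor]
    have h0 : 0 ≤ 2 * π * |besselJ j.natAbs y| := by positivity
    calc ‖w j‖ * (2 * π * |besselJ j.natAbs y|) ≤ A * (2 * π * |besselJ j.natAbs y|) :=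
        mul_le_mul_of_nonneg_right (hA j) h0
      _ = 2 * π * A * |besselJ j.natAbs y| := by ring
  have h := norm_add_sub_sum_range_le_of_hasSum_int y hT J hb
  have e : ∑ j ∈ Finset.range (J + 1), (if j = 0 then (1 : ℂ) else 2)
        * (w j * (2 * π * Complex.I ^ j * (besselJ j y : ℂ)))
      = ∑ n ∈ Finset.range (J + 1), (g n + g (-(n : ℤ))) - g 0 := by
    rw [sum_range_add_neg_sub_eq_sum_eps' g hgs J]
    refine Finset.sum_congr rfl fun j _ => ?_
    simp only [hg, Int.natAbs_natCast]
  rw [e, sub_sub_eq_add_sub]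
  exact h

/-- **Order ball of the FOLDED `cos^a sin²` row (relative form).** For `m ≠ 0` and all `v, y, a, J`:
`‖T^{(a,sin²)}_m(v,y) − Σ_{j≤J} ε_j (W^{(a)}_j − W^{(a+2)}_j)(v) · 2π iʲ J_j(y)‖ ≤ 2π (I_0(v) − I_2(v)) · Σ_{l≥0}|J_{l+J+1}(y)|`
— the kept row's truncation object is the difference of the two cos-power row objects of
`norm_cosPowRow_sub_foldTrunc_le`, and the ball is `2δ_J(y)` times the kept anchor `π(I_0 − I_2)(v)`: no index
shift is used, no `v ≥ 0` and no `a ≤ (J+1)|m|` is needed.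
[cite: FitznerVanDerHofstad2016NoBLE, §3.3.3 p. 1070, §5.1.1 (5.2)–(5.5); DLMF, 10.35.2, 10.32.3, 10.14.4] -/
theorem norm_cosPowSinSqRow_sub_foldTrunc_le (v y : ℝ) {m : ℤ} (hm : m ≠ 0) (a J : ℕ) :
    ‖(∫ t, (((Real.cos t) ^ a * (Real.sin t) ^ 2 : ℝ) : ℂ)
        * Complex.exp (((v * Real.cos t : ℝ) : ℂ) + ((y * Real.cos (m * t) : ℝ) : ℂ) * Complex.I) ∂μI)
      - ∑ j ∈ Finset.range (J + 1), (if j = 0 then (1 : ℂ) else 2)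
          * (((∑ s ∈ Finset.range (a + 1),
                ((a.choose s : ℂ) / 2 ^ a) * (besselI (j * m - ((2 * (s : ℤ) - a : ℤ))) v : ℂ))
              - ∑ s ∈ Finset.range (a + 2 + 1),
                (((a + 2).choose s : ℂ) / 2 ^ (a + 2))
                  * (besselI (j * m - ((2 * (s : ℤ) - (a + 2 : ℕ) : ℤ))) v : ℂ))
            * (2 * π * Complex.I ^ j * (besselJ j y : ℂ)))‖
      ≤ 2 * π * (besselI 0 v - besselI 2 v) * ∑' l : ℕ, |besselJ (l + J + 1) y| := by
  set w : ℤ → ℂ := fun j => (∑ s ∈ Finset.range (a + 1),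
      ((a.choose s : ℂ) / 2 ^ a) * (besselI (j * m - ((2 * (s : ℤ) - a : ℤ))) v : ℂ))
    - ∑ s ∈ Finset.range (a + 2 + 1),
      (((a + 2).choose s : ℂ) / 2 ^ (a + 2))
        * (besselI (j * m - ((2 * (s : ℤ) - (a + 2 : ℕ) : ℤ))) v : ℂ) with hw
  have hT : HasSum (fun j : ℤ => w j * (2 * π * Complex.I ^ j.natAbs * (besselJ j.natAbs y : ℂ)))
      (∫ t, (((Real.cos t) ^ a * (Real.sin t) ^ 2 : ℝ) : ℂ)
        * Complex.exp (((v * Real.cos t : ℝ) : ℂ) + ((y * Real.cos (m * t) : ℝ) : ℂ) * Complex.I) ∂μI) := by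
    rw [integral_cos_pow_mul_sin_sq_row_eq_sub a v y m]
    refine ((hasSum_cos_pow_besselRow_μI a v y hm).sub
      (hasSum_cos_pow_besselRow_μI (a + 2) v y hm)).congr_fun fun j => ?_
    simp only [hw]
    push_cast
    ring
  have hsymm : ∀ n : ℕ, w (-(n : ℤ)) = w n := fun n => by
    simp only [hw]
    rw [cosPowWeight_neg, show (((a + 2 : ℕ) : ℤ)) = ((a + 2 : ℕ) : ℤ) from rfl, cosPowWeight_neg]
  have hA : ∀ j, ‖w j‖ ≤ (besselI 0 v - besselI 2 v) / 2 := fun j => norm_cosPowWeight_sub_le a v m j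
  have h := norm_sub_foldTrunc_le_of_hasSum_of_norm_le y hT hsymm hA J
  calc _ ≤ 2 * (2 * π * ((besselI 0 v - besselI 2 v) / 2)) * ∑' l : ℕ, |besselJ (l + J + 1) y| := h
    _ = 2 * π * (besselI 0 v - besselI 2 v) * ∑' l : ℕ, |besselJ (l + J + 1) y| := by ring

/-- **Order ball of the FOLDED `cos^a sin⁴` row (relative form)** (`j = j′` in `Dhat_pow_mul_Dsin_sq_eq_sum`).
For `m ≠ 0` and all `v, y, a, J`:
`‖T^{(a,sin⁴)}_m(v,y) − Σ_{j≤J} ε_j (W^{(a)}_j − 2W^{(a+2)}_j + W^{(a+4)}_j)(v) · 2π iʲ J_j(y)‖`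
`≤ (π/2)(3I_0 − 4I_2 + I_4)(v) · Σ_{l≥0}|J_{l+J+1}(y)|`.
[cite: FitznerVanDerHofstad2016NoBLE, §3.3.3 p. 1070, §5.1.1 (5.2)–(5.5), §5.2 (5.14) p. 1092; DLMF, 10.35.2, 10.32.3, 10.14.4] -/
theorem norm_cosPowSinSqSinSqRow_sub_foldTrunc_le (v y : ℝ) {m : ℤ} (hm : m ≠ 0) (a J : ℕ) :
    ‖(∫ t, (((Real.cos t) ^ a * (Real.sin t) ^ 2 * (Real.sin t) ^ 2 : ℝ) : ℂ)
        * Complex.exp (((v * Real.cos t : ℝ) : ℂ) + ((y * Real.cos (m * t) : ℝ) : ℂ) * Complex.I) ∂μI)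
      - ∑ j ∈ Finset.range (J + 1), (if j = 0 then (1 : ℂ) else 2)
          * (((∑ s ∈ Finset.range (a + 1),
                ((a.choose s : ℂ) / 2 ^ a) * (besselI (j * m - ((2 * (s : ℤ) - a : ℤ))) v : ℂ))
              - 2 * (∑ s ∈ Finset.range (a + 2 + 1),
                (((a + 2).choose s : ℂ) / 2 ^ (a + 2))
                  * (besselI (j * m - ((2 * (s : ℤ) - (a + 2 : ℕ) : ℤ))) v : ℂ))
              + ∑ s ∈ Finset.range (a + 4 + 1),
                (((a + 4).choose s : ℂ) / 2 ^ (a + 4))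
                  * (besselI (j * m - ((2 * (s : ℤ) - (a + 4 : ℕ) : ℤ))) v : ℂ))
            * (2 * π * Complex.I ^ j * (besselJ j y : ℂ)))‖
      ≤ π / 2 * (3 * besselI 0 v - 4 * besselI 2 v + besselI 4 v) * ∑' l : ℕ, |besselJ (l + J + 1) y| := by
  set w : ℤ → ℂ := fun j => (∑ s ∈ Finset.range (a + 1),
      ((a.choose s : ℂ) / 2 ^ a) * (besselI (j * m - ((2 * (s : ℤ) - a : ℤ))) v : ℂ))
    - 2 * (∑ s ∈ Finset.range (a + 2 + 1),
      (((a + 2).choose s : ℂ) / 2 ^ (a + 2))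
        * (besselI (j * m - ((2 * (s : ℤ) - (a + 2 : ℕ) : ℤ))) v : ℂ))
    + ∑ s ∈ Finset.range (a + 4 + 1),
      (((a + 4).choose s : ℂ) / 2 ^ (a + 4))
        * (besselI (j * m - ((2 * (s : ℤ) - (a + 4 : ℕ) : ℤ))) v : ℂ) with hw
  have hT : HasSum (fun j : ℤ => w j * (2 * π * Complex.I ^ j.natAbs * (besselJ j.natAbs y : ℂ)))
      (∫ t, (((Real.cos t) ^ a * (Real.sin t) ^ 2 * (Real.sin t) ^ 2 : ℝ) : ℂ)
        * Complex.exp (((v * Real.cos t : ℝ) : ℂ) + ((y * Real.cos (m * t) : ℝ) : ℂ) * Complex.I) ∂μI) := by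
    rw [integral_cos_pow_mul_sin_sq_mul_sin_sq_row_eq a v y m]
    refine ((((hasSum_cos_pow_besselRow_μI a v y hm).sub
      ((hasSum_cos_pow_besselRow_μI (a + 2) v y hm).mul_left 2))).add
      (hasSum_cos_pow_besselRow_μI (a + 4) v y hm)).congr_fun fun j => ?_
    simp only [hw]
    push_cast
    ring
  have hsymm : ∀ n : ℕ, w (-(n : ℤ)) = w n := fun n => by
    simp only [hw]
    rw [cosPowWeight_neg, cosPowWeight_neg, cosPowWeight_neg]
  have hA : ∀ j, ‖w j‖ ≤ (3 * besselI 0 v - 4 * besselI 2 v + besselI 4 v) / 8 := fun j =>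
    norm_cosPowWeight_sub_two_mul_add_le a v m j
  have h := norm_sub_foldTrunc_le_of_hasSum_of_norm_le y hT hsymm hA J
  calc _ ≤ 2 * (2 * π * ((3 * besselI 0 v - 4 * besselI 2 v + besselI 4 v) / 8))
        * ∑' l : ℕ, |besselJ (l + J + 1) y| := h
    _ = π / 2 * (3 * besselI 0 v - 4 * besselI 2 v + besselI 4 v)
        * ∑' l : ℕ, |besselJ (l + J + 1) y| := by ring


/-! ### The recurrence form of the kept weights (the explicit `1/v`)

The kept weight `W^{(a)}_j − W^{(a+2)}_j = (2π)⁻¹∫ cos^a t sin²t e^{v cos t} e^{−ijmt} dt` is a sum of modified Bessel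
functions whose leading orders cancel; the recurrence `v(I_{k−1} − I_{k+1}) = 2k I_k` makes the cancellation
explicit: `(2π)⁻¹∫ sin²t e^{v cos t} e^{−ikt} dt = ((k+1) I_{k+1} − (k−1) I_{k−1})(v)/(2v)`.  A kernel evaluating the
kept literal objects termwise needs exactly this form (each term then carries `d/τ` and lands on a finite plain seed
one moment index lower).
-/

/-- The three-term recurrence at every INTEGER order: `x I_{k−1}(x) − x I_{k+1}(x) = 2k I_k(x)` (`k ≥ 1`:
`besselI_recurrence`; `k = 0`: both sides vanish; `k ≤ −1`: evenness `I_{−n} = I_n`). [cite: Amos1974, (1) p. 239; DLMF, 10.29.1] -/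
theorem besselI_recurrence_int (k : ℤ) (x : ℝ) :
    x * besselI (k - 1) x - x * besselI (k + 1) x = 2 * k * besselI k x := by
  obtain ⟨n, rfl | rfl⟩ := Int.eq_nat_or_neg k
  · rcases Nat.eq_zero_or_pos n with rfl | hn
    · rw [show ((0 : ℕ) : ℤ) - 1 = -1 by simp, show ((0 : ℕ) : ℤ) + 1 = 1 by simp, besselI_neg_index]
      simp
    · obtain ⟨m, rfl⟩ := Nat.exists_eq_succ_of_ne_zero hn.ne'
      have h := besselI_recurrence m x
      rw [show ((m.succ : ℕ) : ℤ) - 1 = (m : ℤ) by push_cast; ring,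
        show ((m.succ : ℕ) : ℤ) + 1 = ((m + 2 : ℕ) : ℤ) by push_cast; ring,
        show ((m.succ : ℕ) : ℤ) = ((m + 1 : ℕ) : ℤ) by rfl, h]
      push_cast
      ring
  · rcases Nat.eq_zero_or_pos n with rfl | hn
    · rw [show -((0 : ℕ) : ℤ) - 1 = -1 by simp, show -((0 : ℕ) : ℤ) + 1 = 1 by simp, besselI_neg_index]
      simp
    · obtain ⟨m, rfl⟩ := Nat.exists_eq_succ_of_ne_zero hn.ne'
      have h := besselI_recurrence m x
      rw [show -((m.succ : ℕ) : ℤ) - 1 = -((m + 2 : ℕ) : ℤ) by push_cast; ring,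
        show -((m.succ : ℕ) : ℤ) + 1 = -(m : ℤ) by push_cast; ring,
        show ((m.succ : ℕ) : ℤ) = ((m + 1 : ℕ) : ℤ) by rfl,
        besselI_neg_index, besselI_neg_index, besselI_neg_index]
      push_cast at h ⊢
      linear_combination -h

/-- `½ I_k − ¼ I_{k−2} − ¼ I_{k+2} = ((k+1) I_{k+1} − (k−1) I_{k−1})/(2v)` for `v ≠ 0` (the recurrence at orders
`k+1` and `k−1`). [cite: DLMF, 10.29.1] -/
theorem half_besselI_sub_quarter_sub_quarter_eq {v : ℝ} (hv : v ≠ 0) (k : ℤ) :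
    1 / 2 * besselI k v - 1 / 4 * besselI (k - 2) v - 1 / 4 * besselI (k + 2) v
      = ((k + 1) * besselI (k + 1) v - (k - 1) * besselI (k - 1) v) / (2 * v) := by
  have hr1 := besselI_recurrence_int (k + 1) v
  have hr2 := besselI_recurrence_int (k - 1) v
  rw [add_sub_cancel_right, show k + 1 + 1 = k + 2 by ring] at hr1
  rw [sub_add_cancel, show k - 1 - 1 = k - 2 by ring] at hr2
  push_cast at hr1 hr2
  rw [eq_div_iff (mul_ne_zero two_ne_zero hv)]
  linear_combination (1 / 2 : ℝ) * hr1 - (1 / 2 : ℝ) * hr2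

/-- **`sin²` against a character**: for `v ≠ 0` and every `k ∈ ℤ`,
`∫_{[-π,π]} sin²t · e^{v cos t} e^{−ikt} dt = 2π · ((k+1) I_{k+1}(v) − (k−1) I_{k−1}(v))/(2v)`
(`sin² = ½ − ¼(e^{2it} + e^{−2it})`, DLMF 10.32.3 and the recurrence). [cite: DLMF, 10.32.3, 10.29.1] -/
theorem integral_sin_sq_mul_cexp_mul_cexp_neg_μI {v : ℝ} (hv : v ≠ 0) (k : ℤ) :
    ∫ t, ((Real.sin t ^ 2 : ℝ) : ℂ) * (Complex.exp (((v * Real.cos t : ℝ) : ℂ))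
        * Complex.exp (-((k : ℂ) * t * Complex.I))) ∂μI
      = ((2 * π * (((k + 1) * besselI (k + 1) v - (k - 1) * besselI (k - 1) v) / (2 * v)) : ℝ) : ℂ) := by
  have hX : ∀ r : ℤ, Integrable (fun t : ℝ => Complex.exp (((v * Real.cos t : ℝ) : ℂ))
      * Complex.exp (-((r : ℂ) * t * Complex.I))) μI := by
    intro r
    have hc : Continuous (fun t : ℝ => Complex.exp (((v * Real.cos t : ℝ) : ℂ))
        * Complex.exp (-((r : ℂ) * t * Complex.I))) := by fun_prop
    exact hc.continuousOn.integrableOn_compact isCompact_Icc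
  have hIr : ∀ r : ℤ, ∫ t, Complex.exp (((v * Real.cos t : ℝ) : ℂ)) * Complex.exp (-((r : ℂ) * t * Complex.I)) ∂μI
      = ((2 * π * besselI r v : ℝ) : ℂ) := fun r => integral_cexp_mul_cos_mul_cexp_neg_μI v r
  -- pointwise: sin² e^{−ikt} = ½ e^{−ikt} − ¼ e^{−i(k−2)t} − ¼ e^{−i(k+2)t}
  have hpt : ∀ t : ℝ, ((Real.sin t ^ 2 : ℝ) : ℂ) * (Complex.exp (((v * Real.cos t : ℝ) : ℂ))
      * Complex.exp (-((k : ℂ) * t * Complex.I)))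
      = (1 / 2 : ℂ) * (Complex.exp (((v * Real.cos t : ℝ) : ℂ)) * Complex.exp (-((k : ℂ) * t * Complex.I)))
        - (1 / 4 : ℂ) * (Complex.exp (((v * Real.cos t : ℝ) : ℂ))
          * Complex.exp (-((((k - 2 : ℤ)) : ℂ) * t * Complex.I)))
        - (1 / 4 : ℂ) * (Complex.exp (((v * Real.cos t : ℝ) : ℂ))
          * Complex.exp (-((((k + 2 : ℤ)) : ℂ) * t * Complex.I))) := by
    intro t
    have h2 := Complex.two_cos (2 * t)
    have hsin : ((Real.sin t ^ 2 : ℝ) : ℂ)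
        = 1 / 2 - (Complex.exp (2 * t * Complex.I) + Complex.exp (-(2 * t * Complex.I))) / 4 := by
      push_cast
      rw [Complex.sin_sq, Complex.cos_sq]
      have hc : Complex.cos (2 * t) = (Complex.exp (2 * t * Complex.I) + Complex.exp (-(2 * t * Complex.I))) / 2 := by
        rw [show -(2 * (t : ℂ) * Complex.I) = -(2 * t) * Complex.I by ring]
        linear_combination h2 / 2
      rw [hc]
      ring
    have hX1 : Complex.exp (-((((k - 2 : ℤ)) : ℂ) * t * Complex.I))
        = Complex.exp (2 * t * Complex.I) * Complex.exp (-((k : ℂ) * t * Complex.I)) := by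
      rw [← Complex.exp_add]
      congr 1
      push_cast
      ring
    have hX2 : Complex.exp (-((((k + 2 : ℤ)) : ℂ) * t * Complex.I))
        = Complex.exp (-(2 * t * Complex.I)) * Complex.exp (-((k : ℂ) * t * Complex.I)) := by
      rw [← Complex.exp_add]
      congr 1
      push_cast
      ring
    rw [hsin, hX1, hX2]
    ring
  simp_rw [hpt]
  have hA : Integrable (fun t : ℝ => (1 / 2 : ℂ) * (Complex.exp (((v * Real.cos t : ℝ) : ℂ))
      * Complex.exp (-((k : ℂ) * t * Complex.I)))
        - (1 / 4 : ℂ) * (Complex.exp (((v * Real.cos t : ℝ) : ℂ))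
          * Complex.exp (-((((k - 2 : ℤ)) : ℂ) * t * Complex.I)))) μI :=
    ((hX k).const_mul _).sub ((hX (k - 2)).const_mul _)
  rw [integral_sub hA ((hX (k + 2)).const_mul _),
    integral_sub ((hX k).const_mul _) ((hX (k - 2)).const_mul _), integral_const_mul, integral_const_mul,
    integral_const_mul, hIr k, hIr (k - 2), hIr (k + 2), ← half_besselI_sub_quarter_sub_quarter_eq hv k]
  push_cast
  ring

/-- **The recurrence form of the kept weight**: for `v ≠ 0`,
`W^{(a)}_j(v) − W^{(a+2)}_j(v) = 2^{-a} Σ_{s≤a} C(a,s) · ((k_s+1) I_{k_s+1}(v) − (k_s−1) I_{k_s−1}(v))/(2v)`,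
`k_s = jm − (2s − a)` — every term carries the factor `1/v` explicitly.
[cite: DLMF, 10.29.1, 10.32.3, 10.35.2; FitznerVanDerHofstad2016NoBLE, §5.1.1 (5.2)–(5.4), §5.2 (5.10) p. 1092] -/
theorem cosPowWeight_sub_eq_sum_recurrence (a : ℕ) {v : ℝ} (hv : v ≠ 0) (m j : ℤ) :
    (∑ s ∈ Finset.range (a + 1),
        ((a.choose s : ℂ) / 2 ^ a) * (besselI (j * m - ((2 * (s : ℤ) - a : ℤ))) v : ℂ))
      - ∑ s ∈ Finset.range (a + 2 + 1),
        (((a + 2).choose s : ℂ) / 2 ^ (a + 2))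
          * (besselI (j * m - ((2 * (s : ℤ) - (a + 2 : ℕ) : ℤ))) v : ℂ)
      = ∑ s ∈ Finset.range (a + 1), ((a.choose s : ℂ) / 2 ^ a)
          * (((((j * m - ((2 * (s : ℤ) - a : ℤ)) : ℤ) + 1) * besselI (j * m - ((2 * (s : ℤ) - a : ℤ)) + 1) v
              - ((j * m - ((2 * (s : ℤ) - a : ℤ)) : ℤ) - 1) * besselI (j * m - ((2 * (s : ℤ) - a : ℤ)) - 1) v)
              / (2 * v) : ℝ) : ℂ) := by
  have hπ0 : (0 : ℝ) < 2 * π := by positivity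
  have hπ : (2 * π : ℂ) ≠ 0 := by exact_mod_cast hπ0.ne'
  set K : ℝ → ℂ := fun t => Complex.exp (((v * Real.cos t : ℝ) : ℂ))
    * Complex.exp (-(((j * m : ℤ) : ℂ) * t * Complex.I)) with hK
  have hint : ∀ b : ℕ, Integrable (fun t : ℝ => (((Real.cos t) ^ b : ℝ) : ℂ) * K t) μI := by
    intro b
    have hc : Continuous (fun t : ℝ => (((Real.cos t) ^ b : ℝ) : ℂ) * K t) := by
      simp only [hK]; fun_prop
    exact hc.continuousOn.integrableOn_compact isCompact_Icc
  rw [cosPowWeight_eq_integral a v m j, cosPowWeight_eq_integral (a + 2) v m j, ← mul_sub,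
    ← integral_sub (hint a) (hint (a + 2))]
  have hpt : ∀ t : ℝ, (((Real.cos t) ^ a : ℝ) : ℂ) * K t - (((Real.cos t) ^ (a + 2) : ℝ) : ℂ) * K t
      = ∑ s ∈ Finset.range (a + 1), ((a.choose s : ℂ) / 2 ^ a)
          * (((Real.sin t ^ 2 : ℝ) : ℂ) * (Complex.exp (((v * Real.cos t : ℝ) : ℂ))
            * Complex.exp (-((((j * m - ((2 * (s : ℤ) - a : ℤ)) : ℤ) : ℂ)) * t * Complex.I)))) := by
    intro t
    have h1 : (((Real.cos t) ^ a : ℝ) : ℂ) * K t - (((Real.cos t) ^ (a + 2) : ℝ) : ℂ) * K t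
        = ((Real.sin t ^ 2 : ℝ) : ℂ) * ((((Real.cos t) ^ a : ℝ) : ℂ) * K t) := by
      simp only [Real.sin_sq]
      push_cast
      ring
    rw [h1, ofReal_cos_pow_eq_sum_cexp, Finset.sum_mul, Finset.mul_sum]
    refine Finset.sum_congr rfl fun s _ => ?_
    have he : Complex.exp (-((((j * m - ((2 * (s : ℤ) - a : ℤ)) : ℤ) : ℂ)) * t * Complex.I))
        = Complex.exp ((((2 * (s : ℤ) - a : ℤ)) : ℂ) * t * Complex.I)
          * Complex.exp (-(((j * m : ℤ) : ℂ) * t * Complex.I)) := by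
      rw [← Complex.exp_add]
      congr 1
      push_cast
      ring
    rw [he, hK]
    ring
  simp_rw [hpt]
  have hint2 : ∀ s ∈ Finset.range (a + 1), Integrable (fun t : ℝ => ((a.choose s : ℂ) / 2 ^ a)
      * (((Real.sin t ^ 2 : ℝ) : ℂ) * (Complex.exp (((v * Real.cos t : ℝ) : ℂ))
        * Complex.exp (-((((j * m - ((2 * (s : ℤ) - a : ℤ)) : ℤ) : ℂ)) * t * Complex.I))))) μI := by
    intro s _
    have hc : Continuous (fun t : ℝ => ((a.choose s : ℂ) / 2 ^ a)
        * (((Real.sin t ^ 2 : ℝ) : ℂ) * (Complex.exp (((v * Real.cos t : ℝ) : ℂ))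
          * Complex.exp (-((((j * m - ((2 * (s : ℤ) - a : ℤ)) : ℤ) : ℂ)) * t * Complex.I))))) := by
      fun_prop
    exact hc.continuousOn.integrableOn_compact isCompact_Icc
  rw [integral_finsetSum _ hint2, Finset.mul_sum]
  refine Finset.sum_congr rfl fun s _ => ?_
  rw [integral_const_mul, integral_sin_sq_mul_cexp_mul_cexp_neg_μI hv]
  push_cast
  field_simp

/-! ### Second-order recurrence form (the `j = j′` / sin⁴ kept weight)

`(2π)⁻¹ ∫ sin⁴t e^{v cos t} e^{−ikt} dt = (6I_k − 4I_{k−2} − 4I_{k+2} + I_{k−4} + I_{k+4})(v)/16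
 = ((k+2)(k+3) I_{k+2}(v) − 2k² I_k(v) + (k−2)(k−3) I_{k−2}(v))/(4v²)` (seven instances of the recurrence), so every
term of the `j = j′` kept weight `W^{(a)} − 2W^{(a+2)} + W^{(a+4)}` carries the factor `1/v²` explicitly (a kernel
term then carries `(d/τ)²` and lands on a finite plain seed two moment indices lower).
-/

/-- Seven instances of the three-term recurrence:
`v²(6I_k − 4I_{k−2} − 4I_{k+2} + I_{k−4} + I_{k+4}) = 4((k+2)(k+3)I_{k+2} − 2k²I_k + (k−2)(k−3)I_{k−2})`
at every integer order `k` and every real `v`. [cite: DLMF, 10.29.1; Amos1974, (1) p. 239] -/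
theorem sq_mul_sinFour_besselI_combo_eq (v : ℝ) (k : ℤ) :
    v ^ 2 * (6 * besselI k v - 4 * besselI (k - 2) v - 4 * besselI (k + 2) v
        + besselI (k - 4) v + besselI (k + 4) v)
      = 4 * ((k + 2) * (k + 3) * besselI (k + 2) v - 2 * k ^ 2 * besselI k v
        + (k - 2) * (k - 3) * besselI (k - 2) v) := by
  have r0 := besselI_recurrence_int k v
  have r1 := besselI_recurrence_int (k + 1) v
  have r1' := besselI_recurrence_int (k - 1) v
  have r2 := besselI_recurrence_int (k + 2) v
  have r2' := besselI_recurrence_int (k - 2) v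
  have r3 := besselI_recurrence_int (k + 3) v
  have r3' := besselI_recurrence_int (k - 3) v
  rw [add_sub_cancel_right, show k + 1 + 1 = k + 2 by ring] at r1
  rw [sub_add_cancel, show k - 1 - 1 = k - 2 by ring] at r1'
  rw [show k + 2 - 1 = k + 1 by ring, show k + 2 + 1 = k + 3 by ring] at r2
  rw [show k - 2 - 1 = k - 3 by ring, show k - 2 + 1 = k - 1 by ring] at r2'
  rw [show k + 3 - 1 = k + 2 by ring, show k + 3 + 1 = k + 4 by ring] at r3
  rw [show k - 3 - 1 = k - 4 by ring, show k - 3 + 1 = k - 2 by ring] at r3'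
  push_cast at r0 r1 r1' r2 r2' r3 r3'
  linear_combination (-4 * (k : ℝ)) * r0 + 3 * v * r1 - 3 * v * r1' + 2 * ((k : ℝ) + 3) * r2
    + 2 * ((k : ℝ) - 3) * r2' - v * r3 + v * r3'

/-- Division form: `(6I_k − 4I_{k−2} − 4I_{k+2} + I_{k−4} + I_{k+4})/16
 = ((k+2)(k+3)I_{k+2} − 2k²I_k + (k−2)(k−3)I_{k−2})/(4v²)` for `v ≠ 0`. [cite: DLMF, 10.29.1] -/
theorem sinFour_besselI_combo_eq_div {v : ℝ} (hv : v ≠ 0) (k : ℤ) :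
    1 / 16 * (6 * besselI k v - 4 * besselI (k - 2) v - 4 * besselI (k + 2) v
        + besselI (k - 4) v + besselI (k + 4) v)
      = ((k + 2) * (k + 3) * besselI (k + 2) v - 2 * k ^ 2 * besselI k v
        + (k - 2) * (k - 3) * besselI (k - 2) v) / (4 * v ^ 2) := by
  have h := sq_mul_sinFour_besselI_combo_eq v k
  rw [eq_div_iff (mul_ne_zero (by norm_num : (4 : ℝ) ≠ 0) (pow_ne_zero 2 hv))]
  linear_combination (1 / 4 : ℝ) * h

/-- **`sin⁴` against a character**: for `v ≠ 0` and every `k ∈ ℤ`,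
`∫_{[-π,π]} sin²t sin²t · e^{v cos t} e^{−ikt} dt
 = 2π · ((k+2)(k+3) I_{k+2}(v) − 2k² I_k(v) + (k−2)(k−3) I_{k−2}(v))/(4v²)`
(`sin² = ½ − ¼(e^{2it} + e^{−2it})` applied to one factor, the `sin²` character integral at orders `k, k ± 2`,
and the recurrence). [cite: DLMF, 10.32.3, 10.29.1] -/
theorem integral_sin_sq_mul_sin_sq_mul_cexp_mul_cexp_neg_μI {v : ℝ} (hv : v ≠ 0) (k : ℤ) :
    ∫ t, ((Real.sin t ^ 2 * Real.sin t ^ 2 : ℝ) : ℂ) * (Complex.exp (((v * Real.cos t : ℝ) : ℂ))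
        * Complex.exp (-((k : ℂ) * t * Complex.I))) ∂μI
      = ((2 * π * (((k + 2) * (k + 3) * besselI (k + 2) v - 2 * k ^ 2 * besselI k v
          + (k - 2) * (k - 3) * besselI (k - 2) v) / (4 * v ^ 2)) : ℝ) : ℂ) := by
  have hS : ∀ r : ℤ, Integrable (fun t : ℝ => ((Real.sin t ^ 2 : ℝ) : ℂ)
      * (Complex.exp (((v * Real.cos t : ℝ) : ℂ)) * Complex.exp (-((r : ℂ) * t * Complex.I)))) μI := by
    intro r
    have hc : Continuous (fun t : ℝ => ((Real.sin t ^ 2 : ℝ) : ℂ)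
        * (Complex.exp (((v * Real.cos t : ℝ) : ℂ)) * Complex.exp (-((r : ℂ) * t * Complex.I)))) := by
      fun_prop
    exact hc.continuousOn.integrableOn_compact isCompact_Icc
  have h0 := integral_sin_sq_mul_cexp_mul_cexp_neg_μI hv k
  have h1 := integral_sin_sq_mul_cexp_mul_cexp_neg_μI hv (k - 2)
  have h2 := integral_sin_sq_mul_cexp_mul_cexp_neg_μI hv (k + 2)
  rw [← half_besselI_sub_quarter_sub_quarter_eq hv] at h0 h1 h2
  rw [show k - 2 - 2 = k - 4 by ring, show k - 2 + 2 = k by ring] at h1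
  rw [show k + 2 - 2 = k by ring, show k + 2 + 2 = k + 4 by ring] at h2
  -- pointwise: (sin² e^{−ikt}) sin² E = (½ e^{−ikt} − ¼ e^{−i(k−2)t} − ¼ e^{−i(k+2)t}) sin² E
  have hpt : ∀ t : ℝ, ((Real.sin t ^ 2 * Real.sin t ^ 2 : ℝ) : ℂ) * (Complex.exp (((v * Real.cos t : ℝ) : ℂ))
      * Complex.exp (-((k : ℂ) * t * Complex.I)))
      = (1 / 2 : ℂ) * (((Real.sin t ^ 2 : ℝ) : ℂ) * (Complex.exp (((v * Real.cos t : ℝ) : ℂ))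
          * Complex.exp (-((k : ℂ) * t * Complex.I))))
        - (1 / 4 : ℂ) * (((Real.sin t ^ 2 : ℝ) : ℂ) * (Complex.exp (((v * Real.cos t : ℝ) : ℂ))
          * Complex.exp (-((((k - 2 : ℤ)) : ℂ) * t * Complex.I))))
        - (1 / 4 : ℂ) * (((Real.sin t ^ 2 : ℝ) : ℂ) * (Complex.exp (((v * Real.cos t : ℝ) : ℂ))
          * Complex.exp (-((((k + 2 : ℤ)) : ℂ) * t * Complex.I)))) := by
    intro t
    have h2c := Complex.two_cos (2 * t)
    have hsin : ((Real.sin t ^ 2 : ℝ) : ℂ)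
        = 1 / 2 - (Complex.exp (2 * t * Complex.I) + Complex.exp (-(2 * t * Complex.I))) / 4 := by
      push_cast
      rw [Complex.sin_sq, Complex.cos_sq]
      have hc : Complex.cos (2 * t) = (Complex.exp (2 * t * Complex.I) + Complex.exp (-(2 * t * Complex.I))) / 2 := by
        rw [show -(2 * (t : ℂ) * Complex.I) = -(2 * t) * Complex.I by ring]
        linear_combination h2c / 2
      rw [hc]
      ring
    have hsin4 : ((Real.sin t ^ 2 * Real.sin t ^ 2 : ℝ) : ℂ)
        = (1 / 2 - (Complex.exp (2 * t * Complex.I) + Complex.exp (-(2 * t * Complex.I))) / 4)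
          * ((Real.sin t ^ 2 : ℝ) : ℂ) := by
      rw [← hsin]
      push_cast
      ring
    have hX1 : Complex.exp (-((((k - 2 : ℤ)) : ℂ) * t * Complex.I))
        = Complex.exp (2 * t * Complex.I) * Complex.exp (-((k : ℂ) * t * Complex.I)) := by
      rw [← Complex.exp_add]
      congr 1
      push_cast
      ring
    have hX2 : Complex.exp (-((((k + 2 : ℤ)) : ℂ) * t * Complex.I))
        = Complex.exp (-(2 * t * Complex.I)) * Complex.exp (-((k : ℂ) * t * Complex.I)) := by
      rw [← Complex.exp_add]
      congr 1
      push_cast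
      ring
    rw [hsin4, hX1, hX2]
    ring
  simp_rw [hpt]
  have hA : Integrable (fun t : ℝ => (1 / 2 : ℂ) * (((Real.sin t ^ 2 : ℝ) : ℂ)
      * (Complex.exp (((v * Real.cos t : ℝ) : ℂ)) * Complex.exp (-((k : ℂ) * t * Complex.I))))
        - (1 / 4 : ℂ) * (((Real.sin t ^ 2 : ℝ) : ℂ) * (Complex.exp (((v * Real.cos t : ℝ) : ℂ))
          * Complex.exp (-((((k - 2 : ℤ)) : ℂ) * t * Complex.I))))) μI :=
    ((hS k).const_mul _).sub ((hS (k - 2)).const_mul _)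
  rw [integral_sub hA ((hS (k + 2)).const_mul _),
    integral_sub ((hS k).const_mul _) ((hS (k - 2)).const_mul _), integral_const_mul, integral_const_mul,
    integral_const_mul, h0, h1, h2, ← sinFour_besselI_combo_eq_div hv k]
  push_cast
  ring

/-- **The second-order recurrence form of the kept weight** (`j = j′`): for `v ≠ 0`,
`W^{(a)}_j(v) − 2W^{(a+2)}_j(v) + W^{(a+4)}_j(v)
 = 2^{-a} Σ_{s≤a} C(a,s) · ((k_s+2)(k_s+3) I_{k_s+2} − 2k_s² I_{k_s} + (k_s−2)(k_s−3) I_{k_s−2})(v)/(4v²)`,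
`k_s = jm − (2s − a)` — every term carries the factor `1/v²` explicitly.
[cite: DLMF, 10.29.1, 10.32.3, 10.35.2; FitznerVanDerHofstad2016NoBLE, §5.1.1 (5.2)–(5.4), §5.2 (5.10), (5.14) p. 1092] -/
theorem cosPowWeight_sub_two_mul_add_eq_sum_recurrence (a : ℕ) {v : ℝ} (hv : v ≠ 0) (m j : ℤ) :
    (∑ s ∈ Finset.range (a + 1),
        ((a.choose s : ℂ) / 2 ^ a) * (besselI (j * m - ((2 * (s : ℤ) - a : ℤ))) v : ℂ))
      - 2 * (∑ s ∈ Finset.range (a + 2 + 1),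
        (((a + 2).choose s : ℂ) / 2 ^ (a + 2))
          * (besselI (j * m - ((2 * (s : ℤ) - (a + 2 : ℕ) : ℤ))) v : ℂ))
      + ∑ s ∈ Finset.range (a + 4 + 1),
        (((a + 4).choose s : ℂ) / 2 ^ (a + 4))
          * (besselI (j * m - ((2 * (s : ℤ) - (a + 4 : ℕ) : ℤ))) v : ℂ)
      = ∑ s ∈ Finset.range (a + 1), ((a.choose s : ℂ) / 2 ^ a)
          * (((((((j * m - ((2 * (s : ℤ) - a : ℤ))) : ℤ) : ℝ) + 2) * ((((j * m - ((2 * (s : ℤ) - a : ℤ))) : ℤ) : ℝ) + 3)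
                  * besselI (j * m - ((2 * (s : ℤ) - a : ℤ)) + 2) v
              - 2 * (((j * m - ((2 * (s : ℤ) - a : ℤ))) : ℤ) : ℝ) ^ 2 * besselI (j * m - ((2 * (s : ℤ) - a : ℤ))) v
              + ((((j * m - ((2 * (s : ℤ) - a : ℤ))) : ℤ) : ℝ) - 2) * ((((j * m - ((2 * (s : ℤ) - a : ℤ))) : ℤ) : ℝ) - 3)
                  * besselI (j * m - ((2 * (s : ℤ) - a : ℤ)) - 2) v)
              / (4 * v ^ 2) : ℝ) : ℂ) := by
  have hπ0 : (0 : ℝ) < 2 * π := by positivity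
  have hπ : (2 * π : ℂ) ≠ 0 := by exact_mod_cast hπ0.ne'
  set K : ℝ → ℂ := fun t => Complex.exp (((v * Real.cos t : ℝ) : ℂ))
    * Complex.exp (-(((j * m : ℤ) : ℂ) * t * Complex.I)) with hK
  have hint : ∀ b : ℕ, Integrable (fun t : ℝ => (((Real.cos t) ^ b : ℝ) : ℂ) * K t) μI := by
    intro b
    have hc : Continuous (fun t : ℝ => (((Real.cos t) ^ b : ℝ) : ℂ) * K t) := by
      simp only [hK]; fun_prop
    exact hc.continuousOn.integrableOn_compact isCompact_Icc
  rw [cosPowWeight_eq_integral a v m j, cosPowWeight_eq_integral (a + 2) v m j,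
    cosPowWeight_eq_integral (a + 4) v m j]
  have hcomb : (2 * π : ℂ)⁻¹ * (∫ t, (((Real.cos t) ^ a : ℝ) : ℂ) * K t ∂μI)
      - 2 * ((2 * π : ℂ)⁻¹ * ∫ t, (((Real.cos t) ^ (a + 2) : ℝ) : ℂ) * K t ∂μI)
      + (2 * π : ℂ)⁻¹ * (∫ t, (((Real.cos t) ^ (a + 4) : ℝ) : ℂ) * K t ∂μI)
      = (2 * π : ℂ)⁻¹ * ∫ t, (((Real.cos t) ^ a * Real.sin t ^ 2 * Real.sin t ^ 2 : ℝ) : ℂ) * K t ∂μI := by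
    have hpt : ∀ t : ℝ, (((Real.cos t) ^ a * Real.sin t ^ 2 * Real.sin t ^ 2 : ℝ) : ℂ) * K t
        = ((((Real.cos t) ^ a : ℝ) : ℂ) * K t - 2 * ((((Real.cos t) ^ (a + 2) : ℝ) : ℂ) * K t))
          + (((Real.cos t) ^ (a + 4) : ℝ) : ℂ) * K t := by
      intro t
      simp only [Real.sin_sq]
      push_cast
      ring
    simp_rw [hpt]
    have hAB : Integrable (fun t : ℝ => (((Real.cos t) ^ a : ℝ) : ℂ) * K t
        - 2 * ((((Real.cos t) ^ (a + 2) : ℝ) : ℂ) * K t)) μI :=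
      (hint a).sub ((hint (a + 2)).const_mul 2)
    rw [integral_add hAB (hint (a + 4)), integral_sub (hint a) ((hint (a + 2)).const_mul 2),
      integral_const_mul]
    ring
  rw [hcomb]
  have hpt : ∀ t : ℝ, (((Real.cos t) ^ a * Real.sin t ^ 2 * Real.sin t ^ 2 : ℝ) : ℂ) * K t
      = ∑ s ∈ Finset.range (a + 1), ((a.choose s : ℂ) / 2 ^ a)
          * (((Real.sin t ^ 2 * Real.sin t ^ 2 : ℝ) : ℂ) * (Complex.exp (((v * Real.cos t : ℝ) : ℂ))
            * Complex.exp (-((((j * m - ((2 * (s : ℤ) - a : ℤ)) : ℤ) : ℂ)) * t * Complex.I)))) := by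
    intro t
    have h1 : (((Real.cos t) ^ a * Real.sin t ^ 2 * Real.sin t ^ 2 : ℝ) : ℂ) * K t
        = ((Real.sin t ^ 2 * Real.sin t ^ 2 : ℝ) : ℂ) * ((((Real.cos t) ^ a : ℝ) : ℂ) * K t) := by
      push_cast
      ring
    rw [h1, ofReal_cos_pow_eq_sum_cexp, Finset.sum_mul, Finset.mul_sum]
    refine Finset.sum_congr rfl fun s _ => ?_
    have he : Complex.exp (-((((j * m - ((2 * (s : ℤ) - a : ℤ)) : ℤ) : ℂ)) * t * Complex.I))
        = Complex.exp ((((2 * (s : ℤ) - a : ℤ)) : ℂ) * t * Complex.I)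
          * Complex.exp (-(((j * m : ℤ) : ℂ) * t * Complex.I)) := by
      rw [← Complex.exp_add]
      congr 1
      push_cast
      ring
    rw [he, hK]
    ring
  simp_rw [hpt]
  have hint2 : ∀ s ∈ Finset.range (a + 1), Integrable (fun t : ℝ => ((a.choose s : ℂ) / 2 ^ a)
      * (((Real.sin t ^ 2 * Real.sin t ^ 2 : ℝ) : ℂ) * (Complex.exp (((v * Real.cos t : ℝ) : ℂ))
        * Complex.exp (-((((j * m - ((2 * (s : ℤ) - a : ℤ)) : ℤ) : ℂ)) * t * Complex.I))))) μI := by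
    intro s _
    have hc : Continuous (fun t : ℝ => ((a.choose s : ℂ) / 2 ^ a)
        * (((Real.sin t ^ 2 * Real.sin t ^ 2 : ℝ) : ℂ) * (Complex.exp (((v * Real.cos t : ℝ) : ℂ))
          * Complex.exp (-((((j * m - ((2 * (s : ℤ) - a : ℤ)) : ℤ) : ℂ)) * t * Complex.I))))) := by
      fun_prop
    exact hc.continuousOn.integrableOn_compact isCompact_Icc
  rw [integral_finsetSum _ hint2, Finset.mul_sum]
  refine Finset.sum_congr rfl fun s _ => ?_
  rw [integral_const_mul, integral_sin_sq_mul_sin_sq_mul_cexp_mul_cexp_neg_μI hv]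
  push_cast
  field_simp

end Literature.Probability.FitznerVanDerHofstad2017

end
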